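import Summits.QuantumFields.BalabanUV.Beta.GAN24.MultiplierVertexBondSum

/-!
# `BalabanUV.Beta.GAN24.MultiplierMixedBondSum` — binder row G-an2-4 / (CONV-C), W-slot, road «W3» (SKELETON-W3 v0.2 §7.2): THE MIXED
# BI-VERTEX OF an2's SECOND-ORDER CARRIER HAS ZERO TOTAL BOND SUM IN ITS MULTIPLIER SLOT —
# `Σ'_{y′} mixOfK K N M₂ μ y ν y′ x z a b = 0` POINTWISE (every packed kernel `K` with decay and zero `colM` bond masses — an4's
# `KInvStep Lc j`, raw or dressed, by `GAN24/MultiplierZeroMass` — and every `LocStencilFM` mixed table `M₂` at a positive rate)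
# (idle leaf seat `b2b-balaban-gan24-formalise-leaf-14`, gen 22, invitation «W3-ZB*» part 3; name provisional — the row owner may re-home it)

NOT IN PRINT; OUR BOOKKEEPING.  HONEST FRAMING (cell contract, verbatim): «discharging `BetaPertH` makes Bałaban's UV stability
UNCONDITIONAL — a real constructive-QFT result; it is NOT the continuum limit and NOT the Clay problem.»  HONEST DEPENDENCY (verbatim):
«continuum YM on T⁴ ⇐ BetaPertH ∧ nine spine estimates (0/9 proved); BetaPertH ⇐ (D1) ∧ (D4) ∧ CAP+tail; G-an2-4 gates asym, D1 and
NE2/3/4.»  [folklore] Fubini bookkeeping (one absolutely convergent TRIPLE lattice sum — field-row index `u`, multiplier-column index `w`,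
bond position `y′` — `HasSum.prod_fiberwise` in two orders) over TREE objects BY NAME: an2's `SecondOrderResponse.mixOfK` / `vertexOfM` /
`colM` / `LocStencilFM`, an4's `OneStepKernelFamily.vertexOfK` / `colH`, `OneStepResolventKernel.wsum`, `InterLevelTransport.cwsum_apply`,
`ExpKernelCalculus.Decays`, and `GAN24/MultiplierZeroMass` / `MultiplierVertexBondSum` (zero `colM` masses = fact (S2c); envelopes); no estimate
about Bałaban's tables, no cited fact, no `def`, no `def … : Prop`, no wall binder; 0 sorry.  Discharges NOTHING of «T2Shape» / «T2SupRate» /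
(hW, hWall); NOT «W-slot closed», NEVER «G-an2-4 closed»; NOT BetaPertH, NOT continuum, NOT Clay.

WHY (the located use).  SKELETON-W3 v0.2 §7.2: «Z(mixOfK(K̃, M̃₂)(c, c′)) = 0 (its weights are colM = K̃_mm-columns on a constant: (S2c))».  The
mixed bi-vertex `mixOfK K N M₂ μ y ν y′ = vertexOfK K N (fun κ u ↦ vertexOfM K N (M₂ κ u) ν y′) μ y` reads the field slot of the mixed table
through the field rows `colH` of the `(μ, y)`-column and its multiplier slot through the multiplier rows `colM` of the `(ν, y′)`-column.  Summed
over the bond position `y′` of the MULTIPLIER slot — at fixed field bond `(μ, y)` and fixed entry `(x, z, a, b)` — it vanishes, because for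
each `(u, w)` the bond sum `Σ_{y′} colM K N ν y′ ρ w = 0` ((S2c), `MultiplierZeroMass.hasSum_colM_KInvStep_bond`) and the triple family
`(u, w, y′) ↦ colH K N μ y κ u · colM K N ν y′ ρ w · M₂ κ u ρ w x z a b` converges absolutely (envelope
`C e^{−m|u−N•y|₁} · C₂ e^{−δ|u−N•w|₁} · C e^{−m|w−y′|₁}`).  The swapped mixed term `mixOfK K N M₂ ν y′ μ y` summed over `y` is the SAME lemma
with the two bonds renamed.  This is the pointwise identity by which the mixed channel drops out of the zero mode before any other sum is
taken; the zero-mode functional and its own Fubini are leaf-02-g15's («T2-ZERO-MODE-KERNEL*») and are NOT here.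
* §1 `tsum_exp_coarse_le` (`Σ_w e^{−δ|p−N•w|₁} ≤ Zl(δ)`), `summable_envelope₃`, **`hasSum_mixOfK_bond_of_bound`** (GENERIC `K`, `N ≥ 1`:
  `Decays K C m`, `0 < m`, zero `colM` bond masses, and the POINTWISE envelope `|M₂ κ u ρ w x z a b| ≤ C₂·e^{−δ|u − N•w|₁}`), and
  **`hasSum_mixOfK_bond`** (`LocStencilFM N M₂ C₂ δ`, `0 < δ`); `tsum` form.
* §2 THE STEP INSTANCES `hasSum_mixOfK_KInvStep_bond`, `hasSum_mixOfK_unitK_KInvStep_bond` (hypotheses on `K` discharged BY NAME).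
-/

noncomputable section

open Finset
open scoped BigOperators

namespace Summit.QuantumFields.BalabanUV.Beta.GAN24.MultiplierMixedBondSum

open Literature.MathematicalPhysics.QuantumFieldTheory
open Literature.MathematicalPhysics.QuantumFieldTheory.Balaban1983to89
open Literature.MathematicalPhysics.QuantumFieldTheory.Balaban1983to89.Beta
open AffineAveraging (Site)
open B12Sec2to5 (l1 l1_nonneg)
open ExpKernelCalculus (MKer Decays BiLoc Zl Zl_nonneg summable_exp_shift tsum_exp_shift)
open OneStepResolventKernel (Fib wsum)
open OneStepKernelFamily (KInvStep decays_KInvStep colH vertexOfK abs_colH_le)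
open InterLevelTransport (cwsum_apply)
open SecondOrderResponse (colM vertexOfM mixOfK LocStencilFM)
open Summit.QuantumFields.BalabanUV.Beta.HessKerDressedUnits (unitK decays_unitK)
open Summit.QuantumFields.BalabanUV.Beta.GAN24.MultiplierZeroMass (hasSum_colM_KInvStep_bond hasSum_colM_unitK_KInvStep_bond)
open Summit.QuantumFields.BalabanUV.Beta.GAN24.MultiplierVertexBondSum (zsmul_injective summable_exp_coarse abs_colM_le_fine
  summable_envelope)

variable {d : ℕ}

/-! ## §1 The generic mixed bond-sum lemma -/

section Generic

variable {N : ℕ} [NeZero N]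

/-- [folklore] The coarse-indexed envelope is dominated by the full lattice sum: `Σ_w e^{−δ|p − N•w|₁} ≤ Zl(δ)` (a subseries of nonnegative terms). -/
theorem tsum_exp_coarse_le {δ : ℝ} (hδ : 0 < δ) (p : Site (d + 1)) :
    ∑' w : Site (d + 1), Real.exp (-δ * l1 (p - (N : ℤ) • w)) ≤ Zl (d + 1) δ := by
  rw [← tsum_exp_shift (c := δ) p]
  exact Summable.tsum_le_tsum_of_inj (f := fun w : Site (d + 1) => Real.exp (-δ * l1 (p - (N : ℤ) • w)))
    (g := fun v : Site (d + 1) => Real.exp (-δ * l1 (p - v))) (fun w : Site (d + 1) => (N : ℤ) • w) zsmul_injective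
    (fun c _ => (Real.exp_pos _).le) (fun w => le_rfl) (summable_exp_coarse hδ p) (summable_exp_shift hδ p)

/-- [folklore] The envelope of the TRIPLE family is summable on `ℤ^{d+1} × (ℤ^{d+1} × ℤ^{d+1})` (indices `(u, (w, y′))`):
`Σ C e^{−m|u−N•y|₁} · (C₂ e^{−δ|u−N•w|₁} · C e^{−m|w−y′|₁}) ≤ C·C₂·C·Zl(m)·Zl(δ)·Σ_u e^{−m|u−N•y|₁} < ∞`. -/
theorem summable_envelope₃ {C m C₂ δ : ℝ} (hC : 0 ≤ C) (hm : 0 < m) (hC₂ : 0 ≤ C₂) (hδ : 0 < δ) (y : Site (d + 1)) :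
    Summable (fun q : Site (d + 1) × (Site (d + 1) × Site (d + 1)) =>
      (C * Real.exp (-m * l1 (q.1 - (N : ℤ) • y))) *
        ((C₂ * Real.exp (-δ * l1 (q.1 - (N : ℤ) • q.2.1))) * (C * Real.exp (-m * l1 (q.2.1 - q.2.2))))) := by
  refine (summable_prod_of_nonneg fun q => ?_).2 ⟨fun u => ?_, ?_⟩
  · exact mul_nonneg (mul_nonneg hC (Real.exp_pos _).le)
      (mul_nonneg (mul_nonneg hC₂ (Real.exp_pos _).le) (mul_nonneg hC (Real.exp_pos _).le))
  · have h : Summable (fun r : Site (d + 1) × Site (d + 1) =>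
        (C * Real.exp (-m * l1 (u - (N : ℤ) • y))) *
          ((C₂ * Real.exp (-δ * l1 (u - (N : ℤ) • r.1))) * (C * Real.exp (-m * l1 (r.1 - r.2))))) :=
      (summable_envelope (N := N) hC hm hC₂ hδ u).mul_left _
    exact h
  · -- the inner double sum at fixed `u` is `C₂·C·Zl(m)·Σ_w e^{−δ|u−N•w|₁} ≤ C₂·C·Zl(m)·Zl(δ)`
    have hZm : 0 ≤ Zl (d + 1) m := Zl_nonneg hm
    have inner : ∀ u : Site (d + 1), ∑' r : Site (d + 1) × Site (d + 1),
        (C₂ * Real.exp (-δ * l1 (u - (N : ℤ) • r.1))) * (C * Real.exp (-m * l1 (r.1 - r.2)))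
          = (C₂ * C * Zl (d + 1) m) * ∑' w : Site (d + 1), Real.exp (-δ * l1 (u - (N : ℤ) • w)) := by
      intro u
      have hw : ∀ w : Site (d + 1), Summable (fun y' : Site (d + 1) =>
          (C₂ * Real.exp (-δ * l1 (u - (N : ℤ) • w))) * (C * Real.exp (-m * l1 (w - y')))) :=
        fun w => ((summable_exp_shift hm w).mul_left C).mul_left (C₂ * Real.exp (-δ * l1 (u - (N : ℤ) • w)))
      rw [(summable_envelope (N := N) hC hm hC₂ hδ u).tsum_prod' hw]
      dsimp only
      have e : ∀ w : Site (d + 1), (∑' y' : Site (d + 1),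
          (C₂ * Real.exp (-δ * l1 (u - (N : ℤ) • w))) * (C * Real.exp (-m * l1 (w - y'))))
            = (C₂ * C * Zl (d + 1) m) * Real.exp (-δ * l1 (u - (N : ℤ) • w)) := by
        intro w
        rw [tsum_mul_left, tsum_mul_left, tsum_exp_shift]
        ring
      rw [tsum_congr e, tsum_mul_left]
    have hbound : ∀ u : Site (d + 1), (∑' r : Site (d + 1) × Site (d + 1),
        (C * Real.exp (-m * l1 (u - (N : ℤ) • y))) *
          ((C₂ * Real.exp (-δ * l1 (u - (N : ℤ) • r.1))) * (C * Real.exp (-m * l1 (r.1 - r.2)))))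
          ≤ (C * Real.exp (-m * l1 (u - (N : ℤ) • y))) * ((C₂ * C * Zl (d + 1) m) * Zl (d + 1) δ) := by
      intro u
      rw [tsum_mul_left, inner u]
      refine mul_le_mul_of_nonneg_left ?_ (mul_nonneg hC (Real.exp_pos _).le)
      exact mul_le_mul_of_nonneg_left (tsum_exp_coarse_le hδ u) (by positivity)
    have hnn : ∀ u : Site (d + 1), 0 ≤ ∑' r : Site (d + 1) × Site (d + 1),
        (C * Real.exp (-m * l1 (u - (N : ℤ) • y))) *
          ((C₂ * Real.exp (-δ * l1 (u - (N : ℤ) • r.1))) * (C * Real.exp (-m * l1 (r.1 - r.2)))) :=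
      fun u => tsum_nonneg fun r => mul_nonneg (mul_nonneg hC (Real.exp_pos _).le)
        (mul_nonneg (mul_nonneg hC₂ (Real.exp_pos _).le) (mul_nonneg hC (Real.exp_pos _).le))
    have hmaj : Summable (fun u : Site (d + 1) =>
        (C * Real.exp (-m * l1 (u - (N : ℤ) • y))) * ((C₂ * C * Zl (d + 1) m) * Zl (d + 1) δ)) :=
      ((ExpKernelCalculus.summable_exp_shift' hm ((N : ℤ) • y)).mul_left C).mul_right _
    exact Summable.of_nonneg_of_le hnn hbound hmaj

/-- [folklore] **THE MIXED BI-VERTEX HAS ZERO TOTAL BOND SUM IN ITS MULTIPLIER SLOT (generic form).**  For a packed kernel `K` decaying at rate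
`m > 0` whose multiplier columns have zero bond mass (`Σ_{y′} colM K N ν y′ ρ w = 0`, fact (S2c)) and a mixed table whose entries at
`(x, z, a, b)` are enveloped by `C₂·e^{−δ|u − N•w|₁}` (`δ > 0`): `Σ'_{y′} mixOfK K N M₂ μ y ν y′ x z a b = 0`.  Proof: for each `(κ, ρ)` the
triple family `(u, w, y′) ↦ colH K N μ y κ u · colM K N ν y′ ρ w · M₂ κ u ρ w x z a b` is absolutely summable (`summable_envelope₃`); summed
`y′`-first it vanishes fibrewise over `(u, w)`; summed `(u, w)`-first its fibres are the `wsum ∘ cwsum` literal of `mixOfK`. -/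
theorem hasSum_mixOfK_bond_of_bound {K : MKer (d + 1) (Fib d)} {C m : ℝ} (hK : Decays K C m) (hm : 0 < m)
    (hK0 : ∀ μ ρ w, HasSum (fun y : Site (d + 1) => colM K N μ y ρ w) 0)
    {M₂ : Fin (d + 1) → Site (d + 1) → Fin (d + 1) → Site (d + 1) → MKer (d + 1) (Fib d)} {x z : Site (d + 1)} {a b : Fib d}
    {C₂ δ : ℝ} (hC₂ : 0 ≤ C₂) (hδ : 0 < δ) (hM₂ : ∀ κ u ρ w, |M₂ κ u ρ w x z a b| ≤ C₂ * Real.exp (-δ * l1 (u - (N : ℤ) • w)))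
    (μ : Fin (d + 1)) (y : Site (d + 1)) (ν : Fin (d + 1)) :
    HasSum (fun y' : Site (d + 1) => mixOfK K N M₂ μ y ν y' x z a b) 0 := by
  have hC : 0 ≤ C := hK.nonneg (Sum.inl 0)
  -- one pair of directions `(κ, ρ)` at a time: the triple family indexed by `(y′, (u, w))`
  have key : ∀ κ ρ : Fin (d + 1),
      HasSum (fun y' : Site (d + 1) =>
        ∑' u : Site (d + 1), colH K N μ y κ u * ∑' w : Site (d + 1), colM K N ν y' ρ w * M₂ κ u ρ w x z a b) 0 ∧
      ∀ y' : Site (d + 1), Summable (fun u : Site (d + 1) =>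
        colH K N μ y κ u * ∑' w : Site (d + 1), colM K N ν y' ρ w * M₂ κ u ρ w x z a b) := by
    intro κ ρ
    -- the triple family with outer index `u`, inner `(w, y′)`, and its absolute summability
    have hF_sum : Summable (fun q : Site (d + 1) × (Site (d + 1) × Site (d + 1)) =>
        colH K N μ y κ q.1 * (colM K N ν q.2.2 ρ q.2.1 * M₂ κ q.1 ρ q.2.1 x z a b)) := by
      refine Summable.of_norm_bounded (summable_envelope₃ (N := N) hC hm hC₂ hδ y) fun q => ?_
      rw [Real.norm_eq_abs, abs_mul, abs_mul]
      refine mul_le_mul (abs_colH_le hK μ y κ q.1) ?_ (by positivity) (mul_nonneg hC (Real.exp_pos _).le)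
      rw [mul_comm (C₂ * _)]
      exact mul_le_mul (abs_colM_le_fine hK hm.le ν q.2.2 ρ q.2.1) (hM₂ κ q.1 ρ q.2.1) (abs_nonneg _)
        (mul_nonneg hC (Real.exp_pos _).le)
    -- re-index as `((u, w), y′)`: summing `y′` first gives `0` fibrewise, so the total is `0`
    let e1 : (Site (d + 1) × Site (d + 1)) × Site (d + 1) ≃ Site (d + 1) × (Site (d + 1) × Site (d + 1)) :=
      Equiv.prodAssoc (Site (d + 1)) (Site (d + 1)) (Site (d + 1))
    have hF1 := (Equiv.hasSum_iff e1).mpr hF_sum.hasSum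
    have h0 : HasSum (fun _ : Site (d + 1) × Site (d + 1) => (0 : ℝ))
        (∑' q : Site (d + 1) × (Site (d + 1) × Site (d + 1)),
          colH K N μ y κ q.1 * (colM K N ν q.2.2 ρ q.2.1 * M₂ κ q.1 ρ q.2.1 x z a b)) := by
      refine hF1.prod_fiberwise fun uw => ?_
      have h := ((hK0 ν ρ uw.2).mul_right (M₂ κ uw.1 ρ uw.2 x z a b)).mul_left (colH K N μ y κ uw.1)
      rw [zero_mul, mul_zero] at h
      refine h.congr_fun fun y' => ?_
      simp only [e1, Function.comp_apply, Equiv.prodAssoc_apply]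
    have htot : ∑' q : Site (d + 1) × (Site (d + 1) × Site (d + 1)),
        colH K N μ y κ q.1 * (colM K N ν q.2.2 ρ q.2.1 * M₂ κ q.1 ρ q.2.1 x z a b) = 0 := h0.unique hasSum_zero
    -- re-index as `(y′, (u, w))`: the fibres over `y′` are the iterated `(u, w)` sums
    let e2 : Site (d + 1) × (Site (d + 1) × Site (d + 1)) ≃ Site (d + 1) × (Site (d + 1) × Site (d + 1)) :=
      (Equiv.prodComm (Site (d + 1)) (Site (d + 1) × Site (d + 1))).trans
        (Equiv.prodAssoc (Site (d + 1)) (Site (d + 1)) (Site (d + 1)))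
    have hF2 := (Equiv.hasSum_iff e2).mpr hF_sum.hasSum
    have hS2 := (Equiv.summable_iff e2).mpr hF_sum
    have e2_apply : ∀ (y' u w : Site (d + 1)), e2 (y', (u, w)) = (u, (w, y')) := fun _ _ _ => rfl
    -- the `(u, w)` slice at fixed `y′` and its iterated sum
    have hslice : ∀ y' : Site (d + 1), Summable (fun uw : Site (d + 1) × Site (d + 1) =>
        colH K N μ y κ uw.1 * (colM K N ν y' ρ uw.2 * M₂ κ uw.1 ρ uw.2 x z a b)) := by
      intro y'
      refine (hS2.prod_factor y').congr fun uw => ?_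
      simp only [Function.comp_apply, e2_apply]
    have hslice_w : ∀ (y' u : Site (d + 1)), Summable (fun w : Site (d + 1) =>
        colH K N μ y κ u * (colM K N ν y' ρ w * M₂ κ u ρ w x z a b)) := fun y' u => (hslice y').prod_factor u
    have hiter : ∀ y' : Site (d + 1), ∑' uw : Site (d + 1) × Site (d + 1),
        colH K N μ y κ uw.1 * (colM K N ν y' ρ uw.2 * M₂ κ uw.1 ρ uw.2 x z a b)
          = ∑' u : Site (d + 1), colH K N μ y κ u * ∑' w : Site (d + 1), colM K N ν y' ρ w * M₂ κ u ρ w x z a b := by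
      intro y'
      rw [(hslice y').tsum_prod' (hslice_w y')]
      refine tsum_congr fun u => ?_
      dsimp only
      exact tsum_mul_left
    refine ⟨?_, fun y' => ?_⟩
    · have h1 := hF2.prod_fiberwise fun y' => ((hslice y').hasSum.congr_fun fun uw => by
        simp only [Function.comp_apply, e2_apply])
      rw [htot] at h1
      refine h1.congr_fun fun y' => ?_
      exact (hiter y').symm
    · refine ((hslice y').prod).congr fun u => ?_
      dsimp only
      exact tsum_mul_left
  -- assemble over `κ` and `ρ`
  have hsum := hasSum_sum (s := (Finset.univ : Finset (Fin (d + 1))))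
    fun κ _ => hasSum_sum (s := (Finset.univ : Finset (Fin (d + 1)))) fun ρ _ => (key κ ρ).1
  simp only [Finset.sum_const_zero] at hsum
  refine hsum.congr_fun fun y' => ?_
  -- unfold `mixOfK` down to the iterated literal
  simp only [mixOfK, vertexOfK, wsum, vertexOfM, cwsum_apply]
  refine Finset.sum_congr rfl fun κ _ => ?_
  rw [← Summable.tsum_finsetSum (fun ρ _ => (key κ ρ).2 y')]
  refine tsum_congr fun u => ?_
  rw [Finset.mul_sum]

/-- [folklore] **THE MIXED BI-VERTEX HAS ZERO TOTAL BOND SUM IN ITS MULTIPLIER SLOT for a `LocStencilFM` table** (an1's `mixFF` shape):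
`Σ'_{y′} mixOfK K N M₂ μ y ν y′ x z a b = 0`. -/
theorem hasSum_mixOfK_bond {K : MKer (d + 1) (Fib d)} {C m : ℝ} (hK : Decays K C m) (hm : 0 < m)
    (hK0 : ∀ μ ρ w, HasSum (fun y : Site (d + 1) => colM K N μ y ρ w) 0)
    {M₂ : Fin (d + 1) → Site (d + 1) → Fin (d + 1) → Site (d + 1) → MKer (d + 1) (Fib d)} {C₂ δ : ℝ}
    (hM₂ : LocStencilFM N M₂ C₂ δ) (hδ : 0 < δ)
    (μ : Fin (d + 1)) (y : Site (d + 1)) (ν : Fin (d + 1)) (x z : Site (d + 1)) (a b : Fib d) :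
    HasSum (fun y' : Site (d + 1) => mixOfK K N M₂ μ y ν y' x z a b) 0 := by
  have hC₂ : 0 ≤ C₂ := hM₂.nonneg
  refine hasSum_mixOfK_bond_of_bound hK hm hK0 (C₂ := C₂) hC₂ hδ (fun κ u ρ w => ?_) μ y ν
  refine (hM₂ κ u ρ w x z a b).trans ?_
  have he : Real.exp (-δ * (l1 (x - u) + l1 (z - u))) ≤ 1 := by
    rw [Real.exp_le_one_iff]
    nlinarith [l1_nonneg (x - u), l1_nonneg (z - u)]
  have h0 : 0 ≤ C₂ * Real.exp (-δ * l1 (u - (N : ℤ) • w)) := by positivity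
  calc C₂ * Real.exp (-δ * l1 (u - (N : ℤ) • w)) * Real.exp (-δ * (l1 (x - u) + l1 (z - u)))
      ≤ C₂ * Real.exp (-δ * l1 (u - (N : ℤ) • w)) * 1 := mul_le_mul_of_nonneg_left he h0
    _ = C₂ * Real.exp (-δ * l1 (u - (N : ℤ) • w)) := mul_one _

/-- [folklore] `tsum` form. -/
theorem tsum_mixOfK_bond {K : MKer (d + 1) (Fib d)} {C m : ℝ} (hK : Decays K C m) (hm : 0 < m)
    (hK0 : ∀ μ ρ w, HasSum (fun y : Site (d + 1) => colM K N μ y ρ w) 0)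
    {M₂ : Fin (d + 1) → Site (d + 1) → Fin (d + 1) → Site (d + 1) → MKer (d + 1) (Fib d)} {C₂ δ : ℝ}
    (hM₂ : LocStencilFM N M₂ C₂ δ) (hδ : 0 < δ)
    (μ : Fin (d + 1)) (y : Site (d + 1)) (ν : Fin (d + 1)) (x z : Site (d + 1)) (a b : Fib d) :
    ∑' y' : Site (d + 1), mixOfK K N M₂ μ y ν y' x z a b = 0 :=
  (hasSum_mixOfK_bond hK hm hK0 hM₂ hδ μ y ν x z a b).tsum_eq

end Generic

/-! ## §2 The step instances -/

section Step

variable {Lc : ℕ} [NeZero Lc]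

/-- [folklore] **(S2c) ⇒ THE MIXED BI-VERTEX THROUGH THE STEP KERNEL HAS ZERO MULTIPLIER-SLOT BOND SUM**: for every `LocStencilFM` table at a
positive rate, `Σ'_{y′} mixOfK (KInvStep Lc j) Lc M₂ μ y ν y′ x z a b = 0`. -/
theorem hasSum_mixOfK_KInvStep_bond (j : ℕ)
    {M₂ : Fin (d + 1) → Site (d + 1) → Fin (d + 1) → Site (d + 1) → MKer (d + 1) (Fib d)} {C₂ δ : ℝ}
    (hM₂ : LocStencilFM Lc M₂ C₂ δ) (hδ : 0 < δ)
    (μ : Fin (d + 1)) (y : Site (d + 1)) (ν : Fin (d + 1)) (x z : Site (d + 1)) (a b : Fib d) :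
    HasSum (fun y' : Site (d + 1) => mixOfK (KInvStep (d := d) Lc j) Lc M₂ μ y ν y' x z a b) 0 := by
  obtain ⟨m, C, hm, _, hK⟩ := decays_KInvStep (d := d) (Lc := Lc) j
  exact hasSum_mixOfK_bond hK hm (fun μ ρ w => hasSum_colM_KInvStep_bond j μ ρ w) hM₂ hδ μ y ν x z a b

/-- [folklore] … and through the DRESSED step kernel `unitK s_f s_m (KInvStep Lc j)` of the wall's units (any real `s_f`, `s_m`). -/
theorem hasSum_mixOfK_unitK_KInvStep_bond (sf sm : ℝ) (j : ℕ)
    {M₂ : Fin (d + 1) → Site (d + 1) → Fin (d + 1) → Site (d + 1) → MKer (d + 1) (Fib d)} {C₂ δ : ℝ}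
    (hM₂ : LocStencilFM Lc M₂ C₂ δ) (hδ : 0 < δ)
    (μ : Fin (d + 1)) (y : Site (d + 1)) (ν : Fin (d + 1)) (x z : Site (d + 1)) (a b : Fib d) :
    HasSum (fun y' : Site (d + 1) => mixOfK (unitK sf sm (KInvStep (d := d) Lc j)) Lc M₂ μ y ν y' x z a b) 0 := by
  obtain ⟨m, C, hm, _, hK⟩ := decays_KInvStep (d := d) (Lc := Lc) j
  exact hasSum_mixOfK_bond (decays_unitK (sf := sf) (sm := sm) hK) hm
    (fun μ ρ w => hasSum_colM_unitK_KInvStep_bond sf sm j μ ρ w) hM₂ hδ μ y ν x z a b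

/-- [folklore] `tsum` form of the raw step instance. -/
theorem tsum_mixOfK_KInvStep_bond (j : ℕ)
    {M₂ : Fin (d + 1) → Site (d + 1) → Fin (d + 1) → Site (d + 1) → MKer (d + 1) (Fib d)} {C₂ δ : ℝ}
    (hM₂ : LocStencilFM Lc M₂ C₂ δ) (hδ : 0 < δ)
    (μ : Fin (d + 1)) (y : Site (d + 1)) (ν : Fin (d + 1)) (x z : Site (d + 1)) (a b : Fib d) :
    ∑' y' : Site (d + 1), mixOfK (KInvStep (d := d) Lc j) Lc M₂ μ y ν y' x z a b = 0 :=
  (hasSum_mixOfK_KInvStep_bond j hM₂ hδ μ y ν x z a b).tsum_eq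

end Step

end Summit.QuantumFields.BalabanUV.Beta.GAN24.MultiplierMixedBondSum

end
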